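import Summits.AtomisticToContinuum.HydrodynamicLimit.Theses.InformationPercolationEngine
import Summits.AtomisticToContinuum.HydrodynamicLimit.Theorems.JParityClosureEvenStressEnskogQuadraticTestConvergence
import Literature.MathematicalPhysics.KineticTheory.BoltzmannSolutionsUkaiVelocity
import Mathlib.MeasureTheory.Measure.FiniteMeasureProd
import HarnessLib

/-!
# Weak-limit toolkit for finite measures on `ℝ³` with uniformly integrable second moments

Helper for the line `Sketch` of the crux `InformationPercolationEngine.ChaosClosesEuler`
(stmt-AtomisticToContinuum-15141), skeleton v11 (`Cruxes/ChaosClosesEuler/Lines/Sketch.lean`), registered stub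
`stub_weakLimitToolkit`: if finite Borel measures `μₙ → μ` weakly on `ℝ³` with `|v|²` uniformly integrable, then
`|v|²` is `μ`-integrable, masses, first and second moments converge, and the collisional balance functional
`Bal_ψ(m) = ∫∫∫ ((v−w)·ω)₊ [ψ(v′)+ψ(w′)−ψ(v)−ψ(w)] dω dm dm` (VERBATIM that of
`LimitCollisionMeasure.BalanceRigidity`, stmt-13355) converges for bounded continuous `ψ`.

Structure of the proof (pure measure theory, no definitions):

* `integrable_of_tendsto_of_integral_le` — lower semicontinuity under weak convergence: a continuous `f ≥ 0`
  with `∫ f dμₙ ≤ S` is integrable under the weak limit with `∫ f dμ ≤ S` (truncate, pass to the limit on the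
  bounded continuous truncations, monotone convergence in the level);
* `sq_moment_of_tendsto` — uniform integrability of `‖v‖²` gives integrability under the limit (uniform bound
  on second moments) and convergence of second moments (`ε/4` on the tails of `μₙ`, `ε/4` on the tail of `μ` by
  lower semicontinuity of the continuous tail piece `(‖v‖² − L²)₊ ≤ 1_{L<‖v‖} ‖v‖²`, `ε/2` on the bounded
  truncation `min (‖v‖²) L²` by weak convergence);
* first and mixed second moments then follow from the tree's quadratic-test convergence
  `EvenStressEnskog.stub_quadraticTestConvergence` (`|v_j| ≤ 1 + ‖v‖²`, `|v_j v_k| ≤ ‖v‖²`);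
* `tendsto_prod_of_tendsto` — weak convergence of products `μₙ ⊗ νₙ → μ ⊗ ν` of finite measures, reduced to
  Mathlib's `ProbabilityMeasure.continuous_prod` through `ρ ⊗ τ = (|ρ||τ|) · (ρ̂ ⊗ τ̂)`
  (`prod_eq_mass_smul_normalize_prod`), degenerate limits by masses;
* `tendsto_integral_integral_of_tendsto` — a continuous pair kernel `K` with `|K(v,w)| ≤ D(1+|v|)(1+|w|)`
  passes to the limit in `∫∫ K dμₙ dμₙ` (generalised dominated convergence under weak convergence of
  `μₙ ⊗ μₙ`, `QuadraticTest.tendsto_integral_of_tendsto_integral_dominant`, with the product weight whose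
  integrals `D (∫ (1+|v|) dμₙ)²` converge; Fubini `integral_prod` on both sides);
* the balance kernel `K_ψ(v,w) = ∫_{S²} ((v−w)·ω)₊ [ψ(v′)+ψ(w′)−ψ(v)−ψ(w)] dω` is continuous (compact sphere,
  `UkaiLanford.continuous_integral_sphere`) with `|K_ψ| ≤ |S²| · 4C · (1+|v|)(1+|w|)`.

References: P. Billingsley, *Convergence of Probability Measures*, 2nd ed., Wiley (1999), Thm 2.8 (products),
Thm 3.5 and (3.18) (uniform integrability and convergence of moments).
-/

noncomputable section

namespace Summit.AtomisticToContinuum.HydrodynamicLimit.Theorems.ChaosClosesEulerWeakLimitToolkit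

open scoped BigOperators Topology Classical MeasureTheory ENNReal InnerProductSpace
open Filter Set MeasureTheory
open Literature.MathematicalPhysics.KineticTheory
open Literature.Analysis.FluidPDE
open Summit.AtomisticToContinuum.HydrodynamicLimit.Theses
open Summit.AtomisticToContinuum.HydrodynamicLimit.Theses.InformationPercolationEngine
open Summit.AtomisticToContinuum.HydrodynamicLimit.Theorems.EvenStressEnskog

/-- **Lower semicontinuity under weak convergence.** If finite measures `μₙ → μ` weakly, `f ≥ 0` is
continuous, integrable under every `μₙ` with `∫ f dμₙ ≤ S`, then `f` is `μ`-integrable and `∫ f dμ ≤ S`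
(truncate at level `K`, pass to the weak limit, monotone convergence in `K`). [folklore] -/
theorem integrable_of_tendsto_of_integral_le {Ω : Type*} [MeasurableSpace Ω] [TopologicalSpace Ω]
    [OpensMeasurableSpace Ω] {μs : ℕ → FiniteMeasure Ω} {μ : FiniteMeasure Ω}
    (hμ : Tendsto μs atTop (𝓝 μ)) {f : Ω → ℝ} (hf : Continuous f) (hf0 : ∀ x, 0 ≤ f x)
    (hfi : ∀ n, Integrable f (μs n : Measure Ω)) {S : ℝ}
    (hS : ∀ n, ∫ x, f x ∂(μs n : Measure Ω) ≤ S) :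
    Integrable f (μ : Measure Ω) ∧ ∫ x, f x ∂(μ : Measure Ω) ≤ S := by
  have hKb : ∀ (K : ℕ) (x : Ω), |min (f x) K| ≤ K := fun K x => by
    rw [abs_of_nonneg (le_min (hf0 x) K.cast_nonneg)]
    exact min_le_right _ _
  have hKi : ∀ (K : ℕ) (ρ : Measure Ω) [IsFiniteMeasure ρ], Integrable (fun x => min (f x) K) ρ :=
    fun K ρ _ => QuadraticTest.integrable_of_abs_le (hf.min continuous_const).aestronglyMeasurable (hKb K)
  have hK : ∀ K : ℕ, ∫ x, min (f x) K ∂(μ : Measure Ω) ≤ S := fun K =>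
    le_of_tendsto' (QuadraticTest.tendsto_integral_of_abs_le hμ (hf.min continuous_const) (hKb K))
      fun n => (integral_mono (hKi K _) (hfi n) fun x => min_le_left _ _).trans (hS n)
  have hlin : ∫⁻ x, ENNReal.ofReal (f x) ∂(μ : Measure Ω) ≤ ENNReal.ofReal S := by
    have ht : Tendsto (fun K : ℕ => ∫⁻ x, ENNReal.ofReal (min (f x) K) ∂(μ : Measure Ω)) atTop
        (𝓝 (∫⁻ x, ENNReal.ofReal (f x) ∂(μ : Measure Ω))) := by
      refine lintegral_tendsto_of_tendsto_of_monotone (fun K => ?_) ?_ ?_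
      · exact (hf.min continuous_const).measurable.ennreal_ofReal.aemeasurable
      · exact Eventually.of_forall fun x K K' hKK' =>
          ENNReal.ofReal_le_ofReal (min_le_min_left _ (Nat.cast_le.2 hKK'))
      · refine Eventually.of_forall fun x => (ENNReal.continuous_ofReal.tendsto _).comp ?_
        refine tendsto_const_nhds.congr' ?_
        filter_upwards [eventually_ge_atTop ⌈f x⌉₊] with n hn
        rw [min_eq_left ((Nat.le_ceil _).trans (by exact_mod_cast hn))]
    refine le_of_tendsto' ht fun K => ?_
    rw [← ofReal_integral_eq_lintegral_ofReal (hKi K _)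
      (Eventually.of_forall fun x => le_min (hf0 x) K.cast_nonneg)]
    exact ENNReal.ofReal_le_ofReal (hK K)
  have hint : Integrable f (μ : Measure Ω) :=
    ⟨hf.aestronglyMeasurable, (hasFiniteIntegral_iff_ofReal (Eventually.of_forall hf0)).2
      (hlin.trans_lt ENNReal.ofReal_lt_top)⟩
  refine ⟨hint, ?_⟩
  have hS0 : 0 ≤ S := (integral_nonneg fun x => hf0 x).trans (hS 0)
  rw [integral_eq_lintegral_of_nonneg_ae (Eventually.of_forall hf0) hf.aestronglyMeasurable]
  exact (ENNReal.toReal_mono ENNReal.ofReal_ne_top hlin).trans_eq (ENNReal.toReal_ofReal hS0)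

/-- Masses converge under weak convergence of finite measures (test function `1`). [folklore] -/
theorem tendsto_real_univ {Ω : Type*} [MeasurableSpace Ω] [TopologicalSpace Ω] [OpensMeasurableSpace Ω]
    {ι : Type*} {l : Filter ι} {μs : ι → FiniteMeasure Ω} {μ : FiniteMeasure Ω} (hμ : Tendsto μs l (𝓝 μ)) :
    Tendsto (fun i => (μs i : Measure Ω).real univ) l (𝓝 ((μ : Measure Ω).real univ)) := by
  simpa only [integral_const, smul_eq_mul, mul_one] using QuadraticTest.tendsto_integral_of_abs_le hμ
    (g := fun _ : Ω => (1 : ℝ)) continuous_const (B := 1) fun _ => by norm_num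

/-- A finite measure factors through its normalisation also after taking products:
`ρ ⊗ τ = (|ρ| |τ|) · (ρ̂ ⊗ τ̂)`. [folklore] -/
theorem prod_eq_mass_smul_normalize_prod {α β : Type*} [MeasurableSpace α] [MeasurableSpace β]
    [Nonempty α] [Nonempty β] (ρ : FiniteMeasure α) (τ : FiniteMeasure β) :
    ρ.prod τ = (ρ.mass * τ.mass) • (ρ.normalize.prod τ.normalize).toFiniteMeasure := by
  apply FiniteMeasure.toMeasure_injective
  rw [FiniteMeasure.toMeasure_prod, FiniteMeasure.toMeasure_smul,
    ProbabilityMeasure.toMeasure_comp_toFiniteMeasure_eq_toMeasure, ProbabilityMeasure.toMeasure_prod]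
  conv_lhs => rw [ρ.self_eq_mass_smul_normalize, τ.self_eq_mass_smul_normalize]
  rw [FiniteMeasure.toMeasure_smul, FiniteMeasure.toMeasure_smul,
    ProbabilityMeasure.toMeasure_comp_toFiniteMeasure_eq_toMeasure,
    ProbabilityMeasure.toMeasure_comp_toFiniteMeasure_eq_toMeasure, Measure.prod_smul_left,
    Measure.prod_smul_right, smul_smul]

/-- **Weak convergence of products of finite measures**: if `μᵢ → μ` and `νᵢ → ν` weakly (finite Borel
measures on second-countable metrisable spaces), then `μᵢ ⊗ νᵢ → μ ⊗ ν` weakly (Billingsley 1999, Thm 2.8;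
reduced to Mathlib's `ProbabilityMeasure.continuous_prod` by normalisation, the degenerate limits `μ = 0`
or `ν = 0` being handled by the masses). [folklore] -/
theorem tendsto_prod_of_tendsto {α β : Type*} [MeasurableSpace α] [TopologicalSpace α]
    [SecondCountableTopology α] [TopologicalSpace.PseudoMetrizableSpace α] [OpensMeasurableSpace α]
    [Nonempty α] [MeasurableSpace β] [TopologicalSpace β] [SecondCountableTopology β]
    [TopologicalSpace.PseudoMetrizableSpace β] [OpensMeasurableSpace β] [Nonempty β]
    {ι : Type*} {F : Filter ι} {μs : ι → FiniteMeasure α} {μ : FiniteMeasure α}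
    {νs : ι → FiniteMeasure β} {ν : FiniteMeasure β}
    (hμ : Tendsto μs F (𝓝 μ)) (hν : Tendsto νs F (𝓝 ν)) :
    Tendsto (fun i => (μs i).prod (νs i)) F (𝓝 (μ.prod ν)) := by
  have hm : Tendsto (fun i => (μs i).mass * (νs i).mass) F (𝓝 (μ.mass * ν.mass)) := hμ.mass.mul hν.mass
  by_cases hμ0 : μ = 0
  · subst hμ0
    rw [FiniteMeasure.zero_prod]
    refine FiniteMeasure.tendsto_zero_of_tendsto_zero_mass ?_
    simp only [FiniteMeasure.mass_prod]
    simpa only [FiniteMeasure.zero_mass, zero_mul] using hm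
  by_cases hν0 : ν = 0
  · subst hν0
    rw [FiniteMeasure.prod_zero]
    refine FiniteMeasure.tendsto_zero_of_tendsto_zero_mass ?_
    simp only [FiniteMeasure.mass_prod]
    simpa only [FiniteMeasure.zero_mass, mul_zero] using hm
  have hP : Tendsto (fun i => ((μs i).normalize.prod (νs i).normalize)) F
      (𝓝 (μ.normalize.prod ν.normalize)) :=
    (ProbabilityMeasure.continuous_prod.tendsto (μ.normalize, ν.normalize)).comp
      ((FiniteMeasure.tendsto_normalize_of_tendsto hμ hμ0).prodMk_nhds
        (FiniteMeasure.tendsto_normalize_of_tendsto hν hν0))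
  rw [ProbabilityMeasure.tendsto_nhds_iff_toFiniteMeasure_tendsto_nhds,
    FiniteMeasure.tendsto_iff_forall_testAgainstNN_tendsto] at hP
  rw [FiniteMeasure.tendsto_iff_forall_testAgainstNN_tendsto]
  intro f
  have h := hm.mul (hP f)
  simp only [Function.comp_def] at h
  simp only [prod_eq_mass_smul_normalize_prod, FiniteMeasure.smul_testAgainstNN_apply, smul_eq_mul]
  exact h

/-- **Pair functionals pass to the weak limit.** If `μₙ → μ` weakly on `ℝ³` with integrable and convergent
first absolute moments, and `K` is a continuous pair kernel of growth `|K(v,w)| ≤ D (1+|v|)(1+|w|)`, then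
`∫∫ K dμₙ dμₙ → ∫∫ K dμ dμ` (weak convergence of `μₙ ⊗ μₙ` plus domination by the product weight, whose
integrals `D (∫(1+|v|) dμₙ)²` converge; Fubini). [folklore] -/
theorem tendsto_integral_integral_of_tendsto {μs : ℕ → FiniteMeasure V3} {μ : FiniteMeasure V3}
    (hμ : Tendsto μs atTop (𝓝 μ))
    (h1i : ∀ n, Integrable (fun v : V3 => ‖v‖) (μs n : Measure V3))
    (h1 : Integrable (fun v : V3 => ‖v‖) (μ : Measure V3))
    (h1t : Tendsto (fun n => ∫ v, ‖v‖ ∂(μs n : Measure V3)) atTop (𝓝 (∫ v, ‖v‖ ∂(μ : Measure V3))))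
    {K : V3 × V3 → ℝ} (hK : Continuous K) {D : ℝ}
    (hKD : ∀ p, |K p| ≤ D * ((1 + ‖p.1‖) * (1 + ‖p.2‖))) :
    Tendsto (fun n => ∫ v, ∫ w, K (v, w) ∂(μs n : Measure V3) ∂(μs n : Measure V3)) atTop
      (𝓝 (∫ v, ∫ w, K (v, w) ∂(μ : Measure V3) ∂(μ : Measure V3))) := by
  set wt : V3 × V3 → ℝ := fun p => D * ((1 + ‖p.1‖) * (1 + ‖p.2‖)) with hwt
  have hwc : Continuous wt := by rw [hwt]; fun_prop
  have h1i' : ∀ (ρ : Measure V3) [IsFiniteMeasure ρ], Integrable (fun v : V3 => ‖v‖) ρ →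
      Integrable (fun v : V3 => 1 + ‖v‖) ρ := fun ρ _ h => (integrable_const _).add h
  have hwi : ∀ (ρ : Measure V3) [IsFiniteMeasure ρ], Integrable (fun v : V3 => ‖v‖) ρ →
      Integrable wt (ρ.prod ρ) := fun ρ _ h => ((h1i' ρ h).mul_prod (h1i' ρ h)).const_mul D
  have hw_eq : ∀ (ρ : Measure V3) [IsFiniteMeasure ρ],
      ∫ p, wt p ∂(ρ.prod ρ) = D * ((∫ v, (1 + ‖v‖) ∂ρ) * (∫ v, (1 + ‖v‖) ∂ρ)) := by
    intro ρ _
    rw [hwt, integral_const_mul]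
    congr 1
    exact integral_prod_mul (μ := ρ) (ν := ρ) (fun v : V3 => 1 + ‖v‖) (fun v : V3 => 1 + ‖v‖)
  have hm := tendsto_real_univ hμ
  have h1e : ∀ (ρ : Measure V3) [IsFiniteMeasure ρ], Integrable (fun v : V3 => ‖v‖) ρ →
      ∫ v, (1 + ‖v‖) ∂ρ = ρ.real univ + ∫ v, ‖v‖ ∂ρ := by
    intro ρ _ h
    rw [integral_add (integrable_const _) h, integral_const, smul_eq_mul, mul_one]
  have h1t' : Tendsto (fun n => ∫ v, (1 + ‖v‖) ∂(μs n : Measure V3)) atTop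
      (𝓝 (∫ v, (1 + ‖v‖) ∂(μ : Measure V3))) := by
    rw [h1e _ h1]
    exact (hm.add h1t).congr fun n => (h1e _ (h1i n)).symm
  have hprod : Tendsto (fun n => (μs n).prod (μs n)) atTop (𝓝 (μ.prod μ)) :=
    tendsto_prod_of_tendsto hμ hμ
  have hwt' : Tendsto (fun n => ∫ p, wt p ∂(((μs n).prod (μs n) : FiniteMeasure (V3 × V3)) :
      Measure (V3 × V3))) atTop (𝓝 (∫ p, wt p ∂((μ.prod μ : FiniteMeasure (V3 × V3)) :
      Measure (V3 × V3)))) := by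
    simp only [FiniteMeasure.toMeasure_prod]
    rw [hw_eq]
    refine ((h1t'.mul h1t').const_mul D).congr fun n => ?_
    rw [hw_eq]
  have key := QuadraticTest.tendsto_integral_of_tendsto_integral_dominant
    (μs := fun n => (μs n).prod (μs n)) (ν := μ.prod μ) hprod hK hwc hKD
    (fun n => by simpa only [FiniteMeasure.toMeasure_prod] using hwi _ (h1i n))
    (by simpa only [FiniteMeasure.toMeasure_prod] using hwi _ h1) hwt'
  have hKi : ∀ (ρ : Measure V3) [IsFiniteMeasure ρ], Integrable (fun v : V3 => ‖v‖) ρ →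
      Integrable K (ρ.prod ρ) := fun ρ _ h =>
    (hwi ρ h).mono' hK.aestronglyMeasurable
      (Eventually.of_forall fun p => by rw [Real.norm_eq_abs]; exact hKD p)
  simp only [FiniteMeasure.toMeasure_prod] at key
  rw [integral_prod K (hKi _ h1)] at key
  refine key.congr fun n => ?_
  exact integral_prod K (hKi _ (h1i n))

/-- Truncation bookkeeping for the second moment at level `L²`: `‖v‖² = min (‖v‖²) L² + (‖v‖² - L²)₊`, the
second piece being integrable and dominated by the tail `∫_{L<‖v‖} ‖v‖²`. [folklore] -/
theorem integral_sq_trunc {ρ : Measure V3} [IsFiniteMeasure ρ]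
    (h2 : Integrable (fun v : V3 => ‖v‖ ^ 2) ρ) (L : ℝ) :
    Integrable (fun v : V3 => max (‖v‖ ^ 2 - L ^ 2) 0) ρ ∧
      ∫ v, ‖v‖ ^ 2 ∂ρ = ∫ v, min (‖v‖ ^ 2) (L ^ 2) ∂ρ + ∫ v, max (‖v‖ ^ 2 - L ^ 2) 0 ∂ρ ∧
      ∫ v, max (‖v‖ ^ 2 - L ^ 2) 0 ∂ρ ≤ ∫ v in {v : V3 | L < ‖v‖}, ‖v‖ ^ 2 ∂ρ := by
  have hs : MeasurableSet {v : V3 | L < ‖v‖} := measurableSet_lt measurable_const measurable_norm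
  have hbt : ∀ v : V3, ‖v‖ ^ 2 = min (‖v‖ ^ 2) (L ^ 2) + max (‖v‖ ^ 2 - L ^ 2) 0 := fun v => by
    rcases le_total (‖v‖ ^ 2) (L ^ 2) with h | h
    · rw [min_eq_left h, max_eq_right (by linarith)]; ring
    · rw [min_eq_right h, max_eq_left (by linarith)]; ring
  have htl : ∀ v : V3, max (‖v‖ ^ 2 - L ^ 2) 0 ≤ Set.indicator {v : V3 | L < ‖v‖} (fun v => ‖v‖ ^ 2) v := by
    intro v
    by_cases hv : L ^ 2 < ‖v‖ ^ 2
    · have hLv : L < ‖v‖ := by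
        have h' := sq_lt_sq.1 hv
        rw [abs_norm] at h'
        exact (le_abs_self L).trans_lt h'
      rw [indicator_of_mem (show v ∈ {v : V3 | L < ‖v‖} from hLv)]
      exact max_le (by linarith [sq_nonneg L]) (sq_nonneg _)
    · rw [max_eq_right (by linarith)]
      exact Set.indicator_nonneg (fun w _ => sq_nonneg ‖w‖) v
  have hbi : Integrable (fun v : V3 => min (‖v‖ ^ 2) (L ^ 2)) ρ :=
    QuadraticTest.integrable_of_abs_le (by fun_prop : Continuous fun v : V3 => min (‖v‖ ^ 2) (L ^ 2)).aestronglyMeasurable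
      (B := L ^ 2) fun v => by
        rw [abs_of_nonneg (le_min (sq_nonneg _) (sq_nonneg _))]
        exact min_le_right _ _
  have hti : Integrable (fun v : V3 => max (‖v‖ ^ 2 - L ^ 2) 0) ρ :=
    h2.mono' (by fun_prop : Continuous fun v : V3 => max (‖v‖ ^ 2 - L ^ 2) 0).aestronglyMeasurable
      (Eventually.of_forall fun v => by
        rw [Real.norm_eq_abs, abs_of_nonneg (le_max_right _ _)]
        exact max_le (by linarith [sq_nonneg L]) (sq_nonneg _))
  refine ⟨hti, ?_, ?_⟩
  · rw [← integral_add hbi hti]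
    exact integral_congr_ae (Eventually.of_forall hbt)
  · calc ∫ v, max (‖v‖ ^ 2 - L ^ 2) 0 ∂ρ
        ≤ ∫ v, Set.indicator {v : V3 | L < ‖v‖} (fun v => ‖v‖ ^ 2) v ∂ρ :=
          integral_mono hti (h2.indicator hs) htl
      _ = ∫ v in {v : V3 | L < ‖v‖}, ‖v‖ ^ 2 ∂ρ := integral_indicator hs

/-- **Second moments under uniform integrability**: if `μₙ → μ` weakly on `ℝ³` and `‖v‖²` is uniformly
integrable along `μₙ`, then `‖v‖²` is `μ`-integrable and `∫ ‖v‖² dμₙ → ∫ ‖v‖² dμ` (Billingsley 1999,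
Thm 3.5). [folklore] -/
theorem sq_moment_of_tendsto {μs : ℕ → FiniteMeasure V3} {μ : FiniteMeasure V3}
    (hμ : Tendsto μs atTop (𝓝 μ))
    (h2i : ∀ n, Integrable (fun v : V3 => ‖v‖ ^ 2) (μs n : Measure V3))
    (hUI : ∀ ε : ℝ, 0 < ε → ∃ L : ℝ, ∀ n,
      ∫ v in {v : V3 | L < ‖v‖}, ‖v‖ ^ 2 ∂(μs n : Measure V3) ≤ ε) :
    Integrable (fun v : V3 => ‖v‖ ^ 2) (μ : Measure V3) ∧
      Tendsto (fun n => ∫ v, ‖v‖ ^ 2 ∂(μs n : Measure V3)) atTop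
        (𝓝 (∫ v, ‖v‖ ^ 2 ∂(μ : Measure V3))) := by
  have hbB : ∀ (L : ℝ) (v : V3), |min (‖v‖ ^ 2) (L ^ 2)| ≤ L ^ 2 := fun L v => by
    rw [abs_of_nonneg (le_min (sq_nonneg _) (sq_nonneg _))]
    exact min_le_right _ _
  have hbc : ∀ L : ℝ, Continuous fun v : V3 => min (‖v‖ ^ 2) (L ^ 2) := fun L => by fun_prop
  have htc : ∀ L : ℝ, Continuous fun v : V3 => max (‖v‖ ^ 2 - L ^ 2) 0 := fun L => by fun_prop
  -- masses converge, hence are bounded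
  obtain ⟨M, hM⟩ : ∃ M : ℝ, ∀ n, (μs n : Measure V3).real univ ≤ M := by
    obtain ⟨M, hM⟩ := (tendsto_real_univ hμ).bddAbove_range
    exact ⟨M, fun n => hM ⟨n, rfl⟩⟩
  -- integrability of `‖v‖²` under the limit: second moments are uniformly bounded
  have h2 : Integrable (fun v : V3 => ‖v‖ ^ 2) (μ : Measure V3) := by
    obtain ⟨L, hL⟩ := hUI 1 one_pos
    refine (integrable_of_tendsto_of_integral_le hμ (by fun_prop) (fun v => sq_nonneg _) h2i
      (S := L ^ 2 * M + 1) fun n => ?_).1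
    obtain ⟨-, he, htl⟩ := integral_sq_trunc (h2i n) L
    have hb : ∫ v, min (‖v‖ ^ 2) (L ^ 2) ∂(μs n : Measure V3) ≤ L ^ 2 * M := by
      calc ∫ v, min (‖v‖ ^ 2) (L ^ 2) ∂(μs n : Measure V3)
          ≤ ∫ _v, L ^ 2 ∂(μs n : Measure V3) :=
            integral_mono (QuadraticTest.integrable_of_abs_le (hbc L).aestronglyMeasurable (hbB L))
              (integrable_const _) fun v => min_le_right _ _
        _ = (μs n : Measure V3).real univ * L ^ 2 := by rw [integral_const, smul_eq_mul]
        _ ≤ M * L ^ 2 := mul_le_mul_of_nonneg_right (hM n) (sq_nonneg _)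
        _ = L ^ 2 * M := mul_comm _ _
    linarith [hL n]
  refine ⟨h2, ?_⟩
  rw [Metric.tendsto_atTop]
  intro ε hε
  obtain ⟨L, hL⟩ := hUI (ε / 4) (by positivity)
  -- the tail of the limit is at most `ε / 4` (lower semicontinuity)
  obtain ⟨-, hTμ⟩ := integrable_of_tendsto_of_integral_le hμ (htc L) (fun v => le_max_right _ _)
    (fun n => (integral_sq_trunc (h2i n) L).1) (S := ε / 4)
    fun n => (integral_sq_trunc (h2i n) L).2.2.trans (hL n)
  -- the truncated moments converge (weak convergence)
  obtain ⟨N, hN⟩ := Metric.tendsto_atTop.1 (QuadraticTest.tendsto_integral_of_abs_le hμ (hbc L) (hbB L))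
    (ε / 2) (by positivity)
  refine ⟨N, fun n hn => ?_⟩
  have h1 := hN n hn
  obtain ⟨-, hen, htn⟩ := integral_sq_trunc (h2i n) L
  obtain ⟨-, he, -⟩ := integral_sq_trunc h2 L
  have h4 : 0 ≤ ∫ v, max (‖v‖ ^ 2 - L ^ 2) 0 ∂(μs n : Measure V3) := integral_nonneg fun v => le_max_right _ _
  have h5 : 0 ≤ ∫ v, max (‖v‖ ^ 2 - L ^ 2) 0 ∂(μ : Measure V3) := integral_nonneg fun v => le_max_right _ _
  rw [Real.dist_eq] at h1 ⊢
  rw [hen, he, abs_lt]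
  rw [abs_lt] at h1
  constructor <;> linarith [htn.trans (hL n)]

/-- Registered stub `stub_weakLimitToolkit` of skeleton v11 (line `Sketch`, crux stmt-AtomisticToContinuum-15141): if finite Borel measures `μₙ → μ` weakly on `ℝ³` with `|v|²` uniformly integrable, then `|v|²` is `μ`-integrable, masses, first and second moments converge, and the collisional balance functional `Bal_ψ` (VERBATIM that of `LimitCollisionMeasure.BalanceRigidity`, stmt-13355) converges for bounded continuous `ψ`. [folklore] -/
theorem stub_weakLimitToolkit :
    ∀ (μs : ℕ → FiniteMeasure V3) (μ : FiniteMeasure V3), Tendsto μs atTop (𝓝 μ) →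
      (∀ n, Integrable (fun v : V3 => ‖v‖ ^ 2) (μs n : Measure V3)) →
      (∀ ε : ℝ, 0 < ε → ∃ L : ℝ, ∀ n, ∫ v in {v : V3 | L < ‖v‖}, ‖v‖ ^ 2 ∂(μs n : Measure V3) ≤ ε) →
      let Bal : (V3 → ℝ) → Measure V3 → ℝ := fun ψ m =>
        ∫ v, ∫ w, ∫ ω : Metric.sphere (0 : V3) 1,
          hardSphereKernel (v, w) ω * (ψ (collide ω (v, w)).1 + ψ (collide ω (v, w)).2 - ψ v - ψ w) ∂sphereMeasure ∂m ∂m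
      Integrable (fun v : V3 => ‖v‖ ^ 2) (μ : Measure V3) ∧
      Tendsto (fun n => ((μs n : Measure V3) Set.univ).toReal) atTop (𝓝 ((μ : Measure V3) Set.univ).toReal) ∧
      (∀ j : Fin 3, Tendsto (fun n => ∫ v, v j ∂(μs n : Measure V3)) atTop (𝓝 (∫ v, v j ∂(μ : Measure V3)))) ∧
      (∀ j k : Fin 3, Tendsto (fun n => ∫ v, v j * v k ∂(μs n : Measure V3)) atTop
        (𝓝 (∫ v, v j * v k ∂(μ : Measure V3)))) ∧
      Tendsto (fun n => ∫ v, ‖v‖ ^ 2 ∂(μs n : Measure V3)) atTop (𝓝 (∫ v, ‖v‖ ^ 2 ∂(μ : Measure V3))) ∧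
      (∀ ψ : V3 → ℝ, Continuous ψ → (∃ C : ℝ, ∀ v, |ψ v| ≤ C) →
        Tendsto (fun n => Bal ψ (μs n : Measure V3)) atTop (𝓝 (Bal ψ (μ : Measure V3)))) := by
  intro μs μ hμ h2i hUI
  dsimp only
  obtain ⟨h2, h2t⟩ := sq_moment_of_tendsto hμ h2i hUI
  have hquad := EvenStressEnskog.stub_quadraticTestConvergence atTop μs μ hμ h2i h2 h2t
  have hcoord : ∀ (v : V3) (j : Fin 3), |v j| ≤ ‖v‖ := fun v j => by
    have h := PiLp.norm_apply_le v j
    rwa [Real.norm_eq_abs] at h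
  have hlin : ∀ v : V3, ‖v‖ ≤ 1 + ‖v‖ ^ 2 := fun v => by nlinarith [norm_nonneg v, sq_nonneg (‖v‖ - 1)]
  refine ⟨h2, ?_, fun j => ?_, fun j k => ?_, h2t, fun ψ hψ hC => ?_⟩
  · -- masses
    simpa only [measureReal_def] using tendsto_real_univ hμ
  · -- first moments
    refine hquad (fun v => v j) (by fun_prop) ⟨1, fun v => ?_⟩
    rw [one_mul]
    exact (hcoord v j).trans (hlin v)
  · -- second moments
    refine hquad (fun v => v j * v k) (by fun_prop) ⟨1, fun v => ?_⟩
    rw [one_mul, abs_mul]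
    have := mul_le_mul (hcoord v j) (hcoord v k) (abs_nonneg _) (norm_nonneg _)
    nlinarith
  · -- the balance functional
    obtain ⟨C, hC⟩ := hC
    have hC0 : 0 ≤ C := (abs_nonneg _).trans (hC 0)
    -- first absolute moments
    have h1i : ∀ (ρ : Measure V3) [IsFiniteMeasure ρ], Integrable (fun v : V3 => ‖v‖ ^ 2) ρ →
        Integrable (fun v : V3 => ‖v‖) ρ := fun ρ _ h =>
      ((integrable_const (1 : ℝ)).add h).mono' continuous_norm.aestronglyMeasurable
        (Eventually.of_forall fun v => by rw [norm_norm]; exact hlin v)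
    have h1t : Tendsto (fun n => ∫ v, ‖v‖ ∂(μs n : Measure V3)) atTop (𝓝 (∫ v, ‖v‖ ∂(μ : Measure V3))) :=
      hquad (fun v => ‖v‖) continuous_norm ⟨1, fun v => by rw [one_mul, abs_norm]; exact hlin v⟩
    -- the pair kernel: continuity and linear growth
    set H : V3 × V3 → Metric.sphere (0 : V3) 1 → ℝ := fun p ω =>
      hardSphereKernel p ω * (ψ (collide ω p).1 + ψ (collide ω p).2 - ψ p.1 - ψ p.2) with hH
    have hHc : Continuous (Function.uncurry H) := by
      have hc := Literature.Analysis.FluidPDE.continuous_collide_uncurry (E := V3)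
      have h1 : Continuous (fun q : (V3 × V3) × Metric.sphere (0 : V3) 1 => ψ (collide q.2 q.1).1) :=
        hψ.comp (continuous_fst.comp hc)
      have h2 : Continuous (fun q : (V3 × V3) × Metric.sphere (0 : V3) 1 => ψ (collide q.2 q.1).2) :=
        hψ.comp (continuous_snd.comp hc)
      have h3 : Continuous (fun q : (V3 × V3) × Metric.sphere (0 : V3) 1 => ψ q.1.1) := hψ.comp (by fun_prop)
      have h4 : Continuous (fun q : (V3 × V3) × Metric.sphere (0 : V3) 1 => ψ q.1.2) := hψ.comp (by fun_prop)
      exact UkaiLanford.continuous_hardSphereKernel_uncurry.mul (((h1.add h2).sub h3).sub h4)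
    have hHb : ∀ (p : V3 × V3) (ω : Metric.sphere (0 : V3) 1),
        |H p ω| ≤ (1 + ‖p.1‖) * (1 + ‖p.2‖) * (4 * C) := by
      intro p ω
      rw [hH]
      dsimp only
      rw [abs_mul, abs_of_nonneg (UkaiLanford.hardSphereKernel_nonneg' p ω)]
      refine mul_le_mul (UkaiLanford.hardSphereKernel_le_weight p ω) ?_ (abs_nonneg _) (by positivity)
      have ha := abs_le.1 (hC (collide ω p).1)
      have hb := abs_le.1 (hC (collide ω p).2)
      have hc := abs_le.1 (hC p.1)
      have hd := abs_le.1 (hC p.2)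
      rw [abs_le]
      constructor <;> linarith
    have hKc : Continuous fun p : V3 × V3 => ∫ ω, H p ω ∂sphereMeasure :=
      UkaiLanford.continuous_integral_sphere hHc
    have hKD : ∀ p : V3 × V3, |∫ ω, H p ω ∂sphereMeasure| ≤
        (sphereMeasure : Measure (Metric.sphere (0 : V3) 1)).real univ * (4 * C) * ((1 + ‖p.1‖) * (1 + ‖p.2‖)) := by
      intro p
      have h := UkaiLanford.norm_integral_sphere_le (hHb p)
      rw [Real.norm_eq_abs] at h
      exact h.trans (le_of_eq (by ring))
    have key := tendsto_integral_integral_of_tendsto hμ (fun n => h1i _ (h2i n)) (h1i _ h2) h1t hKc hKD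
    simpa only [hH] using key

end Summit.AtomisticToContinuum.HydrodynamicLimit.Theorems.ChaosClosesEulerWeakLimitToolkit

end
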